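import Summits.Ventures.Crystal3D.Theorems.StickyWulffConstantGenericWallFloorSlotFrameIdentity
import Summits.Ventures.Crystal3D.Theorems.StickyWulffConstantGenericWallFloorMixedDozenRules
import Summits.Ventures.Crystal3D.Theorems.StickyWulffConstantGenericWallFloorCommonSlots
import Summits.Ventures.Crystal3D.Theorems.StickyWulffConstantGenericWallFloorDozenRigidity
import Mathlib.Analysis.InnerProductSpace.Projection.Reflection
import HarnessLib

/-!
# The twin frame of a twin cap: cappers are slots of the reflected grain, and every capper owns a
# linearly independent polar triple (crux `GenericWallFloor`, line `WallLedgerG`; E2/E3 stack propagation)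

HONEST FRAMING. Part of the venture `Summits/Ventures/Crystal3D` (cell `crystal3d-full`), helper
`--supports` the crux `GenericWallFloor` (stmt-Ventures-19480) of `route-Ventures-StickyWulffConstant`,
registered line `WallLedgerG`, open stub `stub_twoSlabAdhesion` — general-filling step.  Both architectures
on the table isolate the same residual: COHERENT TWIN CAPS (19480-p1's `general_twoSlabAdhesion_modulo_twinCaps`,
residual `#TC`; cf-p1's per-ball plan, ROUTE §80(9)/(14): «stacks of cappers … credit deferred to the stack
top»).  This file is the local engine of stack propagation.

**`twinFrame_of_twinCap`.**  Let `e ∈ X` be an exact twin cap of the grain `A` with unit normal `n`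
(`⟪A w, n⟫ ∈ {0, ±√(2/3)}`; in-plane slots occupied; the twin images `e − A w + 2⟪A w, n⟫ n` of the three
positive slots occupied — the conclusion of `exit_twinCap_of_patch` / `twinCap_of_hcpShell`).  Then for the
TWIN FRAME `A′ = R_n ∘ A` (`A′ x = A x − 2⟪A x, n⟫ n`, `R_n = ((ℝ ∙ n)ᗮ).reflection`):
* `⟪A′ w, n⟫ = −⟪A w, n⟫` — `n` is a `{111}` normal of `A′` as well;
* every slot `e + A′ w` with `⟪A′ w, n⟫ ≥ 0` is occupied (the six in-plane balls and the three CAPPERS,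
  which are the positive `A′`-slots of `e`);
* every capper `f = e + A′ w₀` (`⟪A′ w₀, n⟫ > 0`) owns the whole polar triple below it in the frame `A′`:
  `f − A′ w₀ = e`, `f − A′ w₁`, `f − A′ w₂ ∈ X` with `w₀, w₁, w₂` the three positive slots (pairwise adjacent,
  `inner_eq_half_of_pos_pos`; exactly three, 19480-p1's `card_far_slots_eq_three`, …SlotFrameIdentity), and `−w₀, −w₁, −w₂` are LINEARLY
  INDEPENDENT (`linearIndependent_of_pairwise_half`) — precisely the hypothesis of `trichotomy_of_exactOnly`
  / `slots_full_or_twinCap_of_allButOne` (…Trichotomy) for `f` in the frame `A′`: each capper is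
  unsaturated, interior in the twin grain, or twin-capped in turn.

Helpers: `reflection_unit_apply`, `inner_reflection_unit`, `inner_slots_mem`,
`sub_mem_fccSlots_of_inner_eq_half` (the difference of adjacent slots is a slot).

WHAT THIS IS NOT: no global bookkeeping of stacks (E3 / N5); not the stub; rung F-C1 not moved.
-/

noncomputable section

namespace Summit.Ventures.Crystal3D.Theorems

open Finset
open Literature.MathematicalPhysics.StatisticalMechanics (fccStacking constHagg)
open Literature.Barriers.AtomisticToContinuum (barlowAddSubgroupOfConst)
open scoped InnerProductSpace

variable {X : Finset (EuclideanSpace ℝ (Fin 3))}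

/-! ### The reflection across a plane through the origin -/

/-- The reflection `R_n x = x − 2⟪x, n⟫ n` across the plane `n^⊥` (unit `n`), as Mathlib's
`((ℝ ∙ n)ᗮ).reflection`. -/
theorem reflection_unit_apply {n : EuclideanSpace ℝ (Fin 3)} (hn : ‖n‖ = 1) (x : EuclideanSpace ℝ (Fin 3)) :
    (ℝ ∙ n)ᗮ.reflection x = x - (2 * ⟪x, n⟫_ℝ) • n := by
  rw [Submodule.reflection_orthogonal_apply, Submodule.reflection_singleton_apply, hn, real_inner_comm]
  simp only [RCLike.ofReal_real_eq_id, id_eq, one_pow, div_one]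
  rw [neg_sub, two_smul, ← add_smul, ← two_mul]

/-- The reflection flips the `n`-component. -/
theorem inner_reflection_unit {n : EuclideanSpace ℝ (Fin 3)} (hn : ‖n‖ = 1) (x : EuclideanSpace ℝ (Fin 3)) :
    ⟪(ℝ ∙ n)ᗮ.reflection x, n⟫_ℝ = -⟪x, n⟫_ℝ := by
  rw [reflection_unit_apply hn, inner_sub_left, real_inner_smul_left, real_inner_self_eq_norm_sq, hn]
  ring

/-! ### Slot bookkeeping -/

/-- Two slots meet at `0°, 60°, 90°, 120°` or `180°`. -/
theorem inner_slots_mem {w₀ w₁ : EuclideanSpace ℝ (Fin 3)} (hw₀ : w₀ ∈ fccSlots) (hw₁ : w₁ ∈ fccSlots) :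
    ⟪w₀, w₁⟫_ℝ = 1 ∨ ⟪w₀, w₁⟫_ℝ = 1 / 2 ∨ ⟪w₀, w₁⟫_ℝ = 0 ∨ ⟪w₀, w₁⟫_ℝ = -(1 / 2) ∨ ⟪w₀, w₁⟫_ℝ = -1 := by
  have h := inner_mem_of_unit_slots (LinearIsometryEquiv.refl ℝ (EuclideanSpace ℝ (Fin 3)))
    (a := w₀) (b := w₁) ⟨w₀, mem_fcc_of_mem_fccSlots hw₀, rfl⟩ ⟨w₁, mem_fcc_of_mem_fccSlots hw₁, rfl⟩
    (norm_eq_one_of_mem_fccSlots hw₀) (norm_eq_one_of_mem_fccSlots hw₁)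
  exact h

/-- The difference of two ADJACENT slots (`⟪w₀, w₁⟫ = ½`) is a slot. -/
theorem sub_mem_fccSlots_of_inner_eq_half {w₀ w₁ : EuclideanSpace ℝ (Fin 3)} (hw₀ : w₀ ∈ fccSlots)
    (hw₁ : w₁ ∈ fccSlots) (h : ⟪w₀, w₁⟫_ℝ = 1 / 2) : w₀ - w₁ ∈ fccSlots := by
  set G₁ : AddSubgroup (EuclideanSpace ℝ (Fin 3)) :=
    barlowAddSubgroupOfConst 1 (Real.sqrt (2 / 3)) constHagg (fun _ => rfl) with hG₁
  have hG₁mem : ∀ w, w ∈ G₁ ↔ w ∈ fccStacking 1 (Real.sqrt (2 / 3)) := fun w => Iff.rfl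
  have hmem : w₀ - w₁ ∈ fccStacking 1 (Real.sqrt (2 / 3)) :=
    (hG₁mem _).1 (G₁.sub_mem ((hG₁mem _).2 (mem_fcc_of_mem_fccSlots hw₀))
      ((hG₁mem _).2 (mem_fcc_of_mem_fccSlots hw₁)))
  have hnorm : ‖w₀ - w₁‖ = 1 := by
    have h1 : ‖w₀ - w₁‖ ^ 2 = 1 := by
      rw [norm_sub_sq_real, norm_eq_one_of_mem_fccSlots hw₀, norm_eq_one_of_mem_fccSlots hw₁, h]; norm_num
    have h1' : ‖w₀ - w₁‖ ^ 2 = 1 ^ 2 := by rw [h1, one_pow]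
    exact (sq_eq_sq₀ (norm_nonneg _) zero_le_one).1 h1'
  exact mem_fccSlots_of_unit hmem hnorm

/-- **Positive slots of a `{111}` normal are pairwise adjacent.**  If `⟪A w₀, n⟫ > 0` and `⟪A w₁, n⟫ > 0`
(values in the menu `{0, ±√(2/3)}`) and `w₀ ≠ w₁`, then `⟪w₀, w₁⟫ = ½`. -/
theorem inner_eq_half_of_pos_pos (A : EuclideanSpace ℝ (Fin 3) ≃ₗᵢ[ℝ] EuclideanSpace ℝ (Fin 3))
    {n : EuclideanSpace ℝ (Fin 3)} (hn : ‖n‖ = 1)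
    (hmenu : ∀ w ∈ fccSlots, ⟪A w, n⟫_ℝ = 0 ∨ ⟪A w, n⟫_ℝ = Real.sqrt (2 / 3) ∨ ⟪A w, n⟫_ℝ = -Real.sqrt (2 / 3))
    {w₀ w₁ : EuclideanSpace ℝ (Fin 3)} (hw₀ : w₀ ∈ fccSlots) (hw₁ : w₁ ∈ fccSlots) (hne : w₀ ≠ w₁)
    (h₀ : 0 < ⟪A w₀, n⟫_ℝ) (h₁ : 0 < ⟪A w₁, n⟫_ℝ) : ⟪w₀, w₁⟫_ℝ = 1 / 2 := by
  have h23 : Real.sqrt (2 / 3) ^ 2 = 2 / 3 := Real.sq_sqrt (by norm_num)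
  have hs : 0 < Real.sqrt (2 / 3) := Real.sqrt_pos.2 (by norm_num)
  have v₀ : ⟪A w₀, n⟫_ℝ = Real.sqrt (2 / 3) := by
    rcases hmenu w₀ hw₀ with h | h | h <;> [linarith; exact h; linarith]
  have v₁ : ⟪A w₁, n⟫_ℝ = Real.sqrt (2 / 3) := by
    rcases hmenu w₁ hw₁ with h | h | h <;> [linarith; exact h; linarith]
  -- in-plane parts: `pᵢ = A wᵢ − √(2/3) n`, `‖pᵢ‖² = 1/3`, so `⟪A w₀, A w₁⟫ = 2/3 + ⟪p₀, p₁⟫ ≥ 1/3`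
  have n1 : ⟪n, n⟫_ℝ = 1 := by rw [real_inner_self_eq_norm_sq, hn, one_pow]
  have a0 : ⟪A w₀, A w₀⟫_ℝ = 1 := by
    rw [real_inner_self_eq_norm_sq, LinearIsometryEquiv.norm_map, norm_eq_one_of_mem_fccSlots hw₀, one_pow]
  have a1 : ⟪A w₁, A w₁⟫_ℝ = 1 := by
    rw [real_inner_self_eq_norm_sq, LinearIsometryEquiv.norm_map, norm_eq_one_of_mem_fccSlots hw₁, one_pow]
  set p₀ := A w₀ - Real.sqrt (2 / 3) • n with hp₀
  set p₁ := A w₁ - Real.sqrt (2 / 3) • n with hp₁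
  have hp₀n : ⟪p₀, p₀⟫_ℝ = 1 / 3 := by
    rw [hp₀, inner_sub_left, inner_sub_right, inner_sub_right, real_inner_smul_left, real_inner_smul_right,
      real_inner_smul_left, real_inner_smul_right, a0, v₀, real_inner_comm (A w₀) n, v₀, n1]
    nlinarith [h23]
  have hp₁n : ⟪p₁, p₁⟫_ℝ = 1 / 3 := by
    rw [hp₁, inner_sub_left, inner_sub_right, inner_sub_right, real_inner_smul_left, real_inner_smul_right,
      real_inner_smul_left, real_inner_smul_right, a1, v₁, real_inner_comm (A w₁) n, v₁, n1]
    nlinarith [h23]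
  have hdec : ⟪A w₀, A w₁⟫_ℝ = 2 / 3 + ⟪p₀, p₁⟫_ℝ := by
    rw [hp₀, hp₁, inner_sub_left, inner_sub_right, inner_sub_right, real_inner_smul_left, real_inner_smul_right,
      real_inner_smul_left, real_inner_smul_right, v₀, real_inner_comm (A w₁) n, v₁, n1]
    nlinarith [h23]
  have hcs : |⟪p₀, p₁⟫_ℝ| ≤ ‖p₀‖ * ‖p₁‖ := abs_real_inner_le_norm _ _
  have hnp₀ : ‖p₀‖ ^ 2 = 1 / 3 := by rw [← real_inner_self_eq_norm_sq]; exact hp₀n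
  have hnp₁ : ‖p₁‖ ^ 2 = 1 / 3 := by rw [← real_inner_self_eq_norm_sq]; exact hp₁n
  have hprod : ‖p₀‖ * ‖p₁‖ ≤ 1 / 3 := by nlinarith [norm_nonneg p₀, norm_nonneg p₁]
  have hlow : 1 / 3 ≤ ⟪A w₀, A w₁⟫_ℝ := by
    have := neg_abs_le ⟪p₀, p₁⟫_ℝ
    linarith
  have hAA : ⟪A w₀, A w₁⟫_ℝ = ⟪w₀, w₁⟫_ℝ := A.inner_map_map w₀ w₁
  rw [hAA] at hlow
  rcases inner_slots_mem hw₀ hw₁ with h | h | h | h | h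
  · -- equal unit vectors
    exfalso
    have : ‖w₀ - w₁‖ ^ 2 = 0 := by
      rw [norm_sub_sq_real, norm_eq_one_of_mem_fccSlots hw₀, norm_eq_one_of_mem_fccSlots hw₁, h]; norm_num
    exact hne (sub_eq_zero.1 (norm_eq_zero.1 (pow_eq_zero_iff two_ne_zero |>.1 this)))
  · exact h
  · linarith
  · linarith
  · linarith

/-- Three distinct pairwise adjacent slots are linearly independent (Gram determinant `½`). -/
theorem linearIndependent_of_pairwise_half {w₀ w₁ w₂ : EuclideanSpace ℝ (Fin 3)}
    (hw₀ : w₀ ∈ fccSlots) (hw₁ : w₁ ∈ fccSlots) (hw₂ : w₂ ∈ fccSlots)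
    (h01 : ⟪w₀, w₁⟫_ℝ = 1 / 2) (h02 : ⟪w₀, w₂⟫_ℝ = 1 / 2) (h12 : ⟪w₁, w₂⟫_ℝ = 1 / 2) :
    LinearIndependent ℝ ![w₀, w₁, w₂] := by
  have n0 : ⟪w₀, w₀⟫_ℝ = 1 := by rw [real_inner_self_eq_norm_sq, norm_eq_one_of_mem_fccSlots hw₀, one_pow]
  have n1 : ⟪w₁, w₁⟫_ℝ = 1 := by rw [real_inner_self_eq_norm_sq, norm_eq_one_of_mem_fccSlots hw₁, one_pow]
  have n2 : ⟪w₂, w₂⟫_ℝ = 1 := by rw [real_inner_self_eq_norm_sq, norm_eq_one_of_mem_fccSlots hw₂, one_pow]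
  have h10 : ⟪w₁, w₀⟫_ℝ = 1 / 2 := by rw [real_inner_comm]; exact h01
  have h20 : ⟪w₂, w₀⟫_ℝ = 1 / 2 := by rw [real_inner_comm]; exact h02
  have h21 : ⟪w₂, w₁⟫_ℝ = 1 / 2 := by rw [real_inner_comm]; exact h12
  rw [Fintype.linearIndependent_iff]
  intro g hg
  simp only [Fin.sum_univ_three, Matrix.cons_val_zero, Matrix.cons_val_one, Matrix.cons_val] at hg
  have e0 := congrArg (fun v => ⟪v, w₀⟫_ℝ) hg
  have e1 := congrArg (fun v => ⟪v, w₁⟫_ℝ) hg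
  have e2 := congrArg (fun v => ⟪v, w₂⟫_ℝ) hg
  simp only [inner_add_left, real_inner_smul_left, inner_zero_left, n0, n1, n2, h01, h02, h12, h10, h20,
    h21] at e0 e1 e2
  intro i
  fin_cases i
  · show g 0 = 0; linarith
  · show g 1 = 0; linarith
  · show g 2 = 0; linarith

/-! ### The twin frame -/

/-- **TWIN FRAME of a twin cap.**  Let `e ∈ X` be an exact twin cap of the grain `A` with unit normal `n`
(menu `⟪A w, n⟫ ∈ {0, ±√(2/3)}`): the in-plane slots `e + A w` (`⟪A w, n⟫ = 0`) are occupied and the twin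
images `e − A w + 2⟪A w, n⟫ n` of the three positive slots are occupied (the conclusion of
`exit_twinCap_of_patch` / `twinCap_of_hcpShell`).  Then in the TWIN FRAME `A′ = R_n ∘ A`
(`A′ x = A x − 2⟪A x, n⟫ n`):
* `n` is a `{111}` normal of `A′` too (same menu);
* every slot of `e` on the non-negative side, `e + A′ w` with `⟪A′ w, n⟫ ≥ 0`, is occupied (the six in-plane
  balls and the three cappers) — `e` is «full from above» in the twin grain;
* every CAPPER `f = e + A′ w₀` (`⟪A′ w₀, n⟫ > 0`) owns, in the frame `A′`, the whole polar triple BELOW it: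
  `f − A′ w₀ = e`, `f − A′ w₁`, `f − A′ w₂` are occupied, where `w₀, w₁, w₂` are the three positive slots,
  pairwise adjacent, so `−w₀, −w₁, −w₂` are LINEARLY INDEPENDENT occupied slots of `f` — the hypothesis of
  `trichotomy_of_exactOnly` / `slots_full_or_twinCap_of_allButOne` for `f` in the frame `A′`
  (stack propagation: each capper is unsaturated, interior in the twin grain, or twin-capped in turn). -/
theorem twinFrame_of_twinCap (A : EuclideanSpace ℝ (Fin 3) ≃ₗᵢ[ℝ] EuclideanSpace ℝ (Fin 3))
    {n : EuclideanSpace ℝ (Fin 3)} (hn : ‖n‖ = 1)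
    (hmenu : ∀ w ∈ fccSlots, ⟪A w, n⟫_ℝ = 0 ∨ ⟪A w, n⟫_ℝ = Real.sqrt (2 / 3) ∨ ⟪A w, n⟫_ℝ = -Real.sqrt (2 / 3))
    {e : EuclideanSpace ℝ (Fin 3)} (he : e ∈ X)
    (hplane : ∀ w ∈ fccSlots, ⟪A w, n⟫_ℝ = 0 → e + A w ∈ X)
    (hcap : ∀ w ∈ fccSlots, 0 < ⟪A w, n⟫_ℝ → e - A w + (2 * ⟪A w, n⟫_ℝ) • n ∈ X) :
    ∃ A' : EuclideanSpace ℝ (Fin 3) ≃ₗᵢ[ℝ] EuclideanSpace ℝ (Fin 3),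
      (∀ x, A' x = A x - (2 * ⟪A x, n⟫_ℝ) • n) ∧
      (∀ w ∈ fccSlots, ⟪A' w, n⟫_ℝ = -⟪A w, n⟫_ℝ) ∧
      (∀ w ∈ fccSlots, ⟪A' w, n⟫_ℝ = 0 ∨ ⟪A' w, n⟫_ℝ = Real.sqrt (2 / 3) ∨ ⟪A' w, n⟫_ℝ = -Real.sqrt (2 / 3)) ∧
      (∀ w ∈ fccSlots, 0 ≤ ⟪A' w, n⟫_ℝ → e + A' w ∈ X) ∧
      (∀ w₀ ∈ fccSlots, 0 < ⟪A' w₀, n⟫_ℝ →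
        ∃ w₁ ∈ fccSlots, ∃ w₂ ∈ fccSlots, 0 < ⟪A' w₁, n⟫_ℝ ∧ 0 < ⟪A' w₂, n⟫_ℝ ∧
          LinearIndependent ℝ ![-w₀, -w₁, -w₂] ∧
          e + A' w₀ + A' (-w₀) ∈ X ∧ e + A' w₀ + A' (-w₁) ∈ X ∧ e + A' w₀ + A' (-w₂) ∈ X) := by
  classical
  set R : EuclideanSpace ℝ (Fin 3) ≃ₗᵢ[ℝ] EuclideanSpace ℝ (Fin 3) := (ℝ ∙ n)ᗮ.reflection with hR
  refine ⟨A.trans R, ?_, ?_, ?_, ?_, ?_⟩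
  · intro x
    show R (A x) = _
    rw [reflection_unit_apply hn]
  · intro w _
    show ⟪R (A w), n⟫_ℝ = _
    rw [inner_reflection_unit hn]
  · intro w hw
    show ⟪R (A w), n⟫_ℝ = 0 ∨ ⟪R (A w), n⟫_ℝ = _ ∨ ⟪R (A w), n⟫_ℝ = _
    rw [inner_reflection_unit hn]
    rcases hmenu w hw with h | h | h
    · left; rw [h, neg_zero]
    · right; right; rw [h]
    · right; left; rw [h, neg_neg]
  · intro w hw hge
    have hval : ⟪R (A w), n⟫_ℝ = -⟪A w, n⟫_ℝ := inner_reflection_unit hn (A w)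
    change 0 ≤ ⟪R (A w), n⟫_ℝ at hge
    show e + R (A w) ∈ X
    rw [hval] at hge
    rcases (neg_nonneg.1 hge).lt_or_eq with hlt | heq
    · -- a capper: `w = −v` with `⟪A v, n⟫ > 0`
      have hv : -w ∈ fccSlots := neg_mem_fccSlots hw
      have hvpos : 0 < ⟪A (-w), n⟫_ℝ := by rw [map_neg, inner_neg_left]; linarith
      have := hcap (-w) hv hvpos
      rw [reflection_unit_apply hn]
      convert this using 1
      rw [map_neg, inner_neg_left]
      simp only [mul_neg, neg_smul, sub_neg_eq_add]
      abel
    · -- an in-plane slot: fixed by the reflection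
      rw [reflection_unit_apply hn, heq, mul_zero, zero_smul, sub_zero]
      exact hplane w hw heq
  · intro w₀ hw₀ hpos₀
    change 0 < ⟪R (A w₀), n⟫_ℝ at hpos₀
    -- the menu for `A' = R ∘ A`
    have hmenu' : ∀ w ∈ fccSlots, ⟪(A.trans R) w, n⟫_ℝ = 0 ∨ ⟪(A.trans R) w, n⟫_ℝ = Real.sqrt (2 / 3) ∨
        ⟪(A.trans R) w, n⟫_ℝ = -Real.sqrt (2 / 3) := by
      intro w hw
      show ⟪R (A w), n⟫_ℝ = 0 ∨ ⟪R (A w), n⟫_ℝ = _ ∨ ⟪R (A w), n⟫_ℝ = _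
      rw [inner_reflection_unit hn]
      rcases hmenu w hw with h | h | h
      · left; rw [h, neg_zero]
      · right; right; rw [h]
      · right; left; rw [h, neg_neg]
    -- three distinct positive slots
    have hP := card_far_slots_eq_three (A.trans R) hn hmenu'
    obtain ⟨x, y, z, hxy, hxz, hyz, hPeq⟩ := Finset.card_eq_three.1 hP
    have memP : ∀ {v}, v ∈ fccSlots.filter (fun w => 0 < ⟪(A.trans R) w, n⟫_ℝ) ↔
        v ∈ fccSlots ∧ 0 < ⟪R (A v), n⟫_ℝ := fun {v} => by rw [Finset.mem_filter]; rfl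
    have hx := (memP (v := x)).1 (by rw [hPeq]; simp)
    have hy := (memP (v := y)).1 (by rw [hPeq]; simp)
    have hz := (memP (v := z)).1 (by rw [hPeq]; simp)
    have hw₀P : w₀ ∈ ({x, y, z} : Finset (EuclideanSpace ℝ (Fin 3))) := by
      rw [← hPeq]; exact memP.2 ⟨hw₀, hpos₀⟩
    -- pick the two positive slots different from `w₀`
    have key : ∀ w₁ w₂ : EuclideanSpace ℝ (Fin 3), w₁ ∈ fccSlots → w₂ ∈ fccSlots →
        0 < ⟪R (A w₁), n⟫_ℝ → 0 < ⟪R (A w₂), n⟫_ℝ → w₀ ≠ w₁ → w₀ ≠ w₂ → w₁ ≠ w₂ →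
        ∃ w₁ ∈ fccSlots, ∃ w₂ ∈ fccSlots, 0 < ⟪(A.trans R) w₁, n⟫_ℝ ∧ 0 < ⟪(A.trans R) w₂, n⟫_ℝ ∧
          LinearIndependent ℝ ![-w₀, -w₁, -w₂] ∧
          e + (A.trans R) w₀ + (A.trans R) (-w₀) ∈ X ∧ e + (A.trans R) w₀ + (A.trans R) (-w₁) ∈ X ∧
          e + (A.trans R) w₀ + (A.trans R) (-w₂) ∈ X := by
      intro w₁ w₂ hw₁ hw₂ hp₁ hp₂ h01 h02 h12
      have i01 := inner_eq_half_of_pos_pos (A.trans R) hn hmenu' hw₀ hw₁ h01 hpos₀ hp₁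
      have i02 := inner_eq_half_of_pos_pos (A.trans R) hn hmenu' hw₀ hw₂ h02 hpos₀ hp₂
      have i12 := inner_eq_half_of_pos_pos (A.trans R) hn hmenu' hw₁ hw₂ h12 hp₁ hp₂
      have hind := linearIndependent_of_pairwise_half hw₀ hw₁ hw₂ i01 i02 i12
      have hindneg : LinearIndependent ℝ ![-w₀, -w₁, -w₂] := by
        have := linearIndependent_map_triple (LinearIsometryEquiv.neg ℝ) hind
        simpa using this
      -- the differences `w₀ − wᵢ` are in-plane slots of `A'`
      have occ : ∀ w₁, w₁ ∈ fccSlots → 0 < ⟪R (A w₁), n⟫_ℝ → w₀ ≠ w₁ →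
          e + (A.trans R) w₀ + (A.trans R) (-w₁) ∈ X := by
        intro w₁ hw₁ hp₁ h01
        have i01 := inner_eq_half_of_pos_pos (A.trans R) hn hmenu' hw₀ hw₁ h01 hpos₀ hp₁
        have hd : w₀ - w₁ ∈ fccSlots := sub_mem_fccSlots_of_inner_eq_half hw₀ hw₁ i01
        have v₀ : ⟪R (A w₀), n⟫_ℝ = Real.sqrt (2 / 3) := by
          rcases hmenu' w₀ hw₀ with h | h | h
          · exact absurd h (ne_of_gt hpos₀)
          · exact h
          · exfalso; have := Real.sqrt_pos.2 (by norm_num : (0:ℝ) < 2 / 3)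
            change ⟪R (A w₀), n⟫_ℝ = _ at h; linarith
        have v₁ : ⟪R (A w₁), n⟫_ℝ = Real.sqrt (2 / 3) := by
          rcases hmenu' w₁ hw₁ with h | h | h
          · exact absurd h (ne_of_gt hp₁)
          · exact h
          · exfalso; have := Real.sqrt_pos.2 (by norm_num : (0:ℝ) < 2 / 3)
            change ⟪R (A w₁), n⟫_ℝ = _ at h; linarith
        have hzero : ⟪(A.trans R) (w₀ - w₁), n⟫_ℝ = 0 := by
          show ⟪R (A (w₀ - w₁)), n⟫_ℝ = 0
          rw [map_sub, map_sub, inner_sub_left, v₀, v₁, sub_self]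
        have hge : 0 ≤ ⟪(A.trans R) (w₀ - w₁), n⟫_ℝ := hzero.symm.le
        have hocc : e + (A.trans R) (w₀ - w₁) ∈ X := by
          -- from the fourth conclusion, re-derived here
          have hval : ⟪R (A (w₀ - w₁)), n⟫_ℝ = -⟪A (w₀ - w₁), n⟫_ℝ := inner_reflection_unit hn _
          have h0 : ⟪A (w₀ - w₁), n⟫_ℝ = 0 := by
            change ⟪R (A (w₀ - w₁)), n⟫_ℝ = 0 at hzero; linarith
          show e + R (A (w₀ - w₁)) ∈ X
          rw [reflection_unit_apply hn, h0, mul_zero, zero_smul, sub_zero]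
          exact hplane _ hd h0
        convert hocc using 1
        rw [map_sub, map_neg]; abel
      refine ⟨w₁, hw₁, w₂, hw₂, hp₁, hp₂, hindneg, ?_, occ w₁ hw₁ hp₁ h01, occ w₂ hw₂ hp₂ h02⟩
      rw [map_neg, add_neg_cancel_right]; exact he
    simp only [Finset.mem_insert, Finset.mem_singleton] at hw₀P
    rcases hw₀P with rfl | rfl | rfl
    · exact key y z hy.1 hz.1 hy.2 hz.2 hxy hxz hyz
    · exact key x z hx.1 hz.1 hx.2 hz.2 (Ne.symm hxy) hyz hxz
    · exact key x y hx.1 hy.1 hx.2 hy.2 (Ne.symm hxz) (Ne.symm hyz) hxy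

end Summit.Ventures.Crystal3D.Theorems

end
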